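import Summits.AtomisticToContinuum.Crystallization.Theses.ChessboardParticlePlanes
import Summits.AtomisticToContinuum.Crystallization.Theorems.ChessboardParticlePlanesLjPlaneChessboardModeExpansion
import Summits.AtomisticToContinuum.Crystallization.Theorems.ChessboardParticlePlanesLjPlaneChessboardYukawaSliceFourier
import Summits.AtomisticToContinuum.Crystallization.Theorems.ChessboardParticlePlanesLjPlaneChessboardYukawaSlicing
import Literature.Algebra.EuclideanLattices.GaussianLatticeSums

/-!
# Crux `ChessboardParticlePlanes.LjPlaneChessboard` (stmt-AtomisticToContinuum-6709), line `Sketch`,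
# stub `ljLayerModeExpansion` — the planar mode form of a cross-layer Lennard-Jones energy

For a full lattice `L` of a `2`-dimensional real inner-product space `V`, `x ∈ V` and a vertical
offset `z > 0`, the Lennard-Jones energy of the point at height `z` above `x` against the layer
`L × {0}`,
`Σ_{l ∈ L} V_LJ(√(‖x − l‖² + z²))`,
has the MODE FORM
`−(2π / covol L) · Σ_{w ∈ L*} K_z(2π‖w‖) cos(2π⟪x, w⟫)`,
`K_z(q) = ∫_{l > q} W̃(q, l) e^{−lz} dl`,
`W̃(q, l) = (l²−q²)√(l²−q²)/144 − (l²−q²)⁴√(l²−q²)/43545600`,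
both series converging absolutely — GRANTED two one-dimensional inputs which enter as hypotheses
(they are the neighbouring stubs `ljSliceSwap` and `sliceSubstitution` of the skeleton):

1. the Yukawa slicing of Lennard-Jones swapped with a sum (Tonelli),
   `Σ_i V_LJ(R_i) = ∫_{m>0} ω(m) Σ_i e^{−mR_i}/R_i dm`, `ω(m) = m¹⁰/43545600 − m⁴/144`, for any family
   `R_i ≥ z > 0` with `Σ_i R_i⁻⁶ < ∞`;
2. the change of variables `λ = √(m²+q²)` in one mode,
   `∫_{m>0} ω(m) e^{−z√(m²+q²)}/√(m²+q²) dm = −∫_{l>q} W̃(q, l) e^{−lz} dl`.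

Route: (1) with `R_l = √(‖x−l‖²+z²)` (`R_l ≥ z`, and `R_l⁻⁶ ≤ ((1+‖x‖)(1+z⁻¹))⁶ (1+‖l‖)⁻⁶` is
summable over a lattice of the plane, `Fourier.summable_of_decay_zlattice`); under the integral each
Yukawa slice is expanded in modes by the landed `stub_modeExpansionOfFourier stub_yukawaSliceFourier`
(Sommerfeld–Weyl + Poisson); the exchange of `∫_{m>0}` and `Σ_{w ∈ L*}` is dominated, mode by mode, by
`|ω(m)| e^{−zκ}/κ ≤ (m⁹/43545600 + m³/144) e^{−mz/2} · e^{−πz‖w‖}` (`κ = √(m²+(2π‖w‖)²) ≥ m`,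
`κ ≥ (m + 2π‖w‖)/2`), an integrable function of `m` times a summable function of `w`
(`MeasureTheory.integral_tsum_of_summable_integral_norm`); finally (2) evaluates each mode integral.

Main result: `ljLayerModeExpansion` (the registered signature of the skeleton).
-/

noncomputable section

namespace Summit.AtomisticToContinuum.Crystallization.Theorems.ChessboardParticlePlanesLjPlaneChessboard

open Literature.MathematicalPhysics.StatisticalMechanics
open Literature.Algebra.EuclideanLattices
open MeasureTheory
open scoped Real InnerProductSpace FourierTransform

/-! ### Scalar estimates -/

/-- Splitting one dual-side Yukawa mode: for `z, m > 0` and any `q`,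
`e^{-z√(m²+q²)}/√(m²+q²) ≤ e^{-mz/2} e^{-zq/2} / m`, since `√(m²+q²) ≥ m` and
`√(m²+q²) ≥ (m+q)/2`. [folklore] -/
theorem exp_neg_mul_sqrt_sq_add_sq_div_le {z m : ℝ} (q : ℝ) (hz : 0 < z) (hm : 0 < m) :
    Real.exp (-(z * Real.sqrt (m ^ 2 + q ^ 2))) / Real.sqrt (m ^ 2 + q ^ 2) ≤
      Real.exp (-(m * (z / 2))) * Real.exp (-(z / 2 * q)) / m := by
  have h1 : m ≤ Real.sqrt (m ^ 2 + q ^ 2) := Real.le_sqrt_of_sq_le (by nlinarith [sq_nonneg q])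
  have h2 : (m + q) / 2 ≤ Real.sqrt (m ^ 2 + q ^ 2) :=
    Real.le_sqrt_of_sq_le (by nlinarith [sq_nonneg (m - q)])
  rw [← Real.exp_add, show -(m * (z / 2)) + -(z / 2 * q) = -(z * ((m + q) / 2)) by ring]
  gcongr

/-- Domination of one mode integrand: for `z, m > 0`, any `q` and `|c| ≤ 1`,
`|ω(m) · e^{-z√(m²+q²)}/√(m²+q²) · c| ≤ (m⁹/43545600 + m³/144) e^{-mz/2} · e^{-zq/2}`,
`ω(m) = m¹⁰/43545600 − m⁴/144`. [folklore] -/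
theorem norm_ljModeIntegrand_le {z m c : ℝ} (q : ℝ) (hz : 0 < z) (hm : 0 < m) (hc : |c| ≤ 1) :
    ‖(m ^ 10 / 43545600 - m ^ 4 / 144) *
        (Real.exp (-(z * Real.sqrt (m ^ 2 + q ^ 2))) / Real.sqrt (m ^ 2 + q ^ 2) * c)‖ ≤
      (1 / 43545600 * (m ^ 9 * Real.exp (-(m * (z / 2)))) +
          1 / 144 * (m ^ 3 * Real.exp (-(m * (z / 2))))) * Real.exp (-(z / 2 * q)) := by
  have hE : (0 : ℝ) ≤ Real.exp (-(z * Real.sqrt (m ^ 2 + q ^ 2))) / Real.sqrt (m ^ 2 + q ^ 2) := by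
    positivity
  rw [Real.norm_eq_abs, abs_mul, abs_mul, abs_of_nonneg hE]
  have hω : |m ^ 10 / 43545600 - m ^ 4 / 144| ≤ m ^ 10 / 43545600 + m ^ 4 / 144 := by
    refine (abs_sub _ _).trans (le_of_eq ?_)
    rw [abs_of_nonneg (by positivity), abs_of_nonneg (by positivity)]
  have hle := exp_neg_mul_sqrt_sq_add_sq_div_le q hz hm
  calc |m ^ 10 / 43545600 - m ^ 4 / 144| *
        (Real.exp (-(z * Real.sqrt (m ^ 2 + q ^ 2))) / Real.sqrt (m ^ 2 + q ^ 2) * |c|)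
      ≤ (m ^ 10 / 43545600 + m ^ 4 / 144) *
          (Real.exp (-(m * (z / 2))) * Real.exp (-(z / 2 * q)) / m * 1) := by gcongr
    _ = (1 / 43545600 * (m ^ 9 * Real.exp (-(m * (z / 2)))) +
          1 / 144 * (m ^ 3 * Real.exp (-(m * (z / 2))))) * Real.exp (-(z / 2 * q)) := by
        field_simp

/-- The mode integrand `m ↦ ω(m) · e^{-z√(m²+q²)}/√(m²+q²) · c` is continuous on `(0, ∞)` (its
denominator is `≥ m > 0` there). [folklore] -/
theorem continuousOn_ljModeIntegrand (z q c : ℝ) :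
    ContinuousOn (fun m : ℝ => (m ^ 10 / 43545600 - m ^ 4 / 144) *
      (Real.exp (-(z * Real.sqrt (m ^ 2 + q ^ 2))) / Real.sqrt (m ^ 2 + q ^ 2) * c)) (Set.Ioi 0) := by
  have h : ∀ m ∈ Set.Ioi (0 : ℝ), Real.sqrt (m ^ 2 + q ^ 2) ≠ 0 := fun m hm => by
    have hm' : (0 : ℝ) < m := hm
    exact (Real.sqrt_pos.2 (by positivity)).ne'
  fun_prop (disch := exact h)

/-- The dominating function `m ↦ m⁹ e^{-mr}/43545600 + m³ e^{-mr}/144` is integrable on `(0, ∞)`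
for `r > 0` (Euler integrals, `integrableOn_pow_mul_exp_neg_mul_Ioi`). [folklore] -/
theorem integrableOn_ljModeDominant {r : ℝ} (hr : 0 < r) :
    IntegrableOn (fun m : ℝ => 1 / 43545600 * (m ^ 9 * Real.exp (-(m * r))) +
      1 / 144 * (m ^ 3 * Real.exp (-(m * r)))) (Set.Ioi 0) :=
  ((integrableOn_pow_mul_exp_neg_mul_Ioi 9 hr).const_mul _).add
    ((integrableOn_pow_mul_exp_neg_mul_Ioi 3 hr).const_mul _)

/-- Domination of the inverse slice radius by a power of the norm:
`(√(‖x−v‖²+z²))⁻¹ ^ 6 ≤ ((1+‖x‖)(1+z⁻¹))⁶ (1+‖v‖)⁻⁶` for `z > 0`, from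
`1 + ‖v‖ ≤ 1 + ‖x‖ + ‖x − v‖ ≤ (1+‖x‖)(1+z⁻¹) √(‖x−v‖²+z²)`. [folklore] -/
theorem inv_sqrt_norm_sub_sq_add_sq_pow_six_le {E : Type*} [NormedAddCommGroup E] {z : ℝ}
    (hz : 0 < z) (x v : E) :
    (Real.sqrt (‖x - v‖ ^ 2 + z ^ 2))⁻¹ ^ 6 ≤
      ((1 + ‖x‖) * (1 + z⁻¹)) ^ 6 * (1 + ‖v‖) ^ (-(6 : ℝ)) := by
  have hzR : z ≤ Real.sqrt (‖x - v‖ ^ 2 + z ^ 2) :=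
    Real.le_sqrt_of_sq_le (by nlinarith [sq_nonneg ‖x - v‖])
  have hR : 0 < Real.sqrt (‖x - v‖ ^ 2 + z ^ 2) := hz.trans_le hzR
  have haR : ‖x - v‖ ≤ Real.sqrt (‖x - v‖ ^ 2 + z ^ 2) :=
    Real.le_sqrt_of_sq_le (by nlinarith [sq_nonneg z])
  have hv : ‖v‖ ≤ ‖x‖ + ‖x - v‖ := by
    have h := norm_sub_le x (x - v)
    rwa [sub_sub_cancel] at h
  have hv1 : 0 < 1 + ‖v‖ := by positivity
  have h1 : 1 ≤ z⁻¹ * Real.sqrt (‖x - v‖ ^ 2 + z ^ 2) := by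
    rw [← div_eq_inv_mul, one_le_div hz]
    exact hzR
  have key : 1 + ‖v‖ ≤ Real.sqrt (‖x - v‖ ^ 2 + z ^ 2) * ((1 + ‖x‖) * (1 + z⁻¹)) := by
    nlinarith [mul_le_mul_of_nonneg_left h1 (norm_nonneg x), mul_nonneg (norm_nonneg x) hR.le]
  have hinv : (Real.sqrt (‖x - v‖ ^ 2 + z ^ 2))⁻¹ ≤ (1 + ‖x‖) * (1 + z⁻¹) * (1 + ‖v‖)⁻¹ := by
    rw [← div_eq_mul_inv, le_div_iff₀ hv1, inv_mul_le_iff₀ hR]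
    exact key
  calc (Real.sqrt (‖x - v‖ ^ 2 + z ^ 2))⁻¹ ^ 6
      ≤ ((1 + ‖x‖) * (1 + z⁻¹) * (1 + ‖v‖)⁻¹) ^ 6 := pow_le_pow_left₀ (inv_nonneg.2 hR.le) hinv 6
    _ = ((1 + ‖x‖) * (1 + z⁻¹)) ^ 6 * (1 + ‖v‖) ^ (-(6 : ℝ)) := by
        rw [mul_pow, Real.rpow_neg hv1.le, show (6 : ℝ) = ((6 : ℕ) : ℝ) by norm_num,
          Real.rpow_natCast, inv_pow]

/-- Exponentials are summable over a full lattice of a space of dimension `< 3`: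
`Σ_{w ∈ Λ} e^{-s · 2π‖w‖} < ∞` for `s > 0` (`e^{-t‖w‖} ≤ (6eᵗ/t³)(1+‖w‖)⁻³`,
`Fourier.summable_of_decay_zlattice`). [folklore] -/
theorem summable_exp_neg_mul_norm_zlattice {V : Type*} [NormedAddCommGroup V]
    [InnerProductSpace ℝ V] [FiniteDimensional ℝ V] (Λ : Submodule ℤ V) [DiscreteTopology Λ]
    [IsZLattice ℝ Λ] (hV : (Module.finrank ℝ V : ℝ) < 3) {s : ℝ} (hs : 0 < s) :
    Summable fun w : Λ => Real.exp (-(s * (2 * π * ‖(w : V)‖))) := by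
  have ht : 0 < s * (2 * π) := by positivity
  have h := Literature.NumberTheory.LFunctions.Fourier.summable_of_decay_zlattice Λ hV
    (g := fun v : V => ((Real.exp (-(s * (2 * π * ‖v‖))) : ℝ) : ℂ)) fun v => by
      rw [Complex.norm_real, Real.norm_of_nonneg (Real.exp_pos _).le,
        show s * (2 * π * ‖v‖) = s * (2 * π) * ‖v‖ by ring]
      exact exp_neg_mul_le_rpow_neg_three ht (norm_nonneg v)
  exact Complex.summable_ofReal.1 h

/-! ### Dominated exchange of `∫_{m>0}` and a countable sum -/

/-- **Dominated exchange of `∫_{(0,∞)}` and `Σ'`.** If each `F i` is a.e.-strongly measurable on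
`(0, ∞)` and `|F i m| ≤ g(m) a_i` there with `g` integrable on `(0, ∞)` and `Σ a_i < ∞`, then every
`F i` is integrable on `(0, ∞)`, `i ↦ ∫_{m>0} F i m` is summable, and
`∫_{m>0} Σ'_i F i m = Σ'_i ∫_{m>0} F i m` (`MeasureTheory.integral_tsum_of_summable_integral_norm`).
[folklore] -/
theorem integral_Ioi_tsum_of_dominated {ι : Type*} [Countable ι] {F : ι → ℝ → ℝ} {g : ℝ → ℝ}
    {a : ι → ℝ} (hF : ∀ i, AEStronglyMeasurable (F i) (volume.restrict (Set.Ioi (0 : ℝ))))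
    (hg : IntegrableOn g (Set.Ioi (0 : ℝ))) (ha : Summable a)
    (hle : ∀ i, ∀ m ∈ Set.Ioi (0 : ℝ), ‖F i m‖ ≤ g m * a i) :
    (∀ i, IntegrableOn (F i) (Set.Ioi (0 : ℝ))) ∧
      Summable (fun i => ∫ m in Set.Ioi (0 : ℝ), F i m) ∧
      ∫ m in Set.Ioi (0 : ℝ), ∑' i, F i m = ∑' i, ∫ m in Set.Ioi (0 : ℝ), F i m := by
  have hae : ∀ i, ∀ᵐ m ∂volume.restrict (Set.Ioi (0 : ℝ)), ‖F i m‖ ≤ g m * a i := fun i =>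
    (ae_restrict_iff' measurableSet_Ioi).2 (Filter.Eventually.of_forall (hle i))
  have hint : ∀ i, Integrable (F i) (volume.restrict (Set.Ioi (0 : ℝ))) := fun i =>
    (hg.mul_const (a i)).mono' (hF i) (hae i)
  have hbound : ∀ i, ∫ m in Set.Ioi (0 : ℝ), ‖F i m‖ ≤ (∫ m in Set.Ioi (0 : ℝ), g m) * a i :=
    fun i => by
      rw [← integral_mul_const]
      exact integral_mono_ae (hint i).norm (hg.mul_const (a i)) (hae i)
  have hsum : Summable fun i => ∫ m in Set.Ioi (0 : ℝ), ‖F i m‖ :=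
    Summable.of_nonneg_of_le (fun i => integral_nonneg fun m => norm_nonneg _) hbound
      (ha.mul_left _)
  exact ⟨hint, hsum.of_norm_bounded fun i => norm_integral_le_integral_norm _,
    (integral_tsum_of_summable_integral_norm hint hsum).symm⟩

/-! ### The mode form of the cross-layer Lennard-Jones energy -/

/-- **Stub `ljLayerModeExpansion` — planar mode form of a cross-layer Lennard-Jones energy (L).**
GIVEN (hypothesis 1) the Tonelli swap `Σ_i V_LJ(R_i) = ∫_{m>0} ω(m) Σ_i e^{−mR_i}/R_i dm`
(`ω(m) = m¹⁰/43545600 − m⁴/144`) for any family `R_i ≥ z > 0` with `Σ R_i⁻⁶ < ∞`, and GIVEN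
(hypothesis 2) the change of variables
`∫_{m>0} ω(m) e^{−z√(m²+q²)}/√(m²+q²) dm = −∫_{l>q} W̃(q,l) e^{−lz} dl`,
`W̃(q,l) = (l²−q²)√(l²−q²)/144 − (l²−q²)⁴√(l²−q²)/43545600`: for every full lattice `L` of a
`2`-dimensional real inner-product space `V`, `x ∈ V`, `z > 0`, the series
`Σ_{l∈L} V_LJ(√(‖x−l‖²+z²))` and its dual series converge and
`Σ_{l∈L} V_LJ(√(‖x−l‖²+z²)) = −(2π / covol L) · Σ_{w∈L*} (∫_{l > 2π‖w‖} W̃(2π‖w‖, l) e^{−lz} dl) · cos(2π⟪x,w⟫)`.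
Route: hypothesis 1 with `R_l = √(‖x−l‖²+z²)` (`inv_sqrt_norm_sub_sq_add_sq_pow_six_le`,
`Fourier.summable_of_decay_zlattice`); the landed mode expansion of each Yukawa slice
(`stub_modeExpansionOfFourier stub_yukawaSliceFourier`) under the integral; the dominated exchange
`integral_Ioi_tsum_of_dominated` with the bound `norm_ljModeIntegrand_le`; hypothesis 2 mode by mode.
[folklore; cf. GiulianiLebowitzLieb2006 §3] -/
theorem ljLayerModeExpansion :
    (∀ (ι : Type) (R : ι → ℝ) (z : ℝ), 0 < z → (∀ i, z ≤ R i) → Summable (fun i => (R i)⁻¹ ^ 6) →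
      Summable (fun i => lennardJones (R i)) ∧
      (∀ m : ℝ, 0 < m → Summable (fun i => Real.exp (-(m * R i)) / R i)) ∧
      MeasureTheory.IntegrableOn
        (fun m : ℝ => (m ^ 10 / 43545600 - m ^ 4 / 144) * ∑' i, Real.exp (-(m * R i)) / R i)
        (Set.Ioi 0) ∧
      ∑' i, lennardJones (R i) =
        ∫ m in Set.Ioi (0 : ℝ), (m ^ 10 / 43545600 - m ^ 4 / 144) * ∑' i, Real.exp (-(m * R i)) / R i) →
    (∀ (q z : ℝ), 0 ≤ q → 0 < z →
      MeasureTheory.IntegrableOn (fun l : ℝ =>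
          ((l ^ 2 - q ^ 2) * Real.sqrt (l ^ 2 - q ^ 2) / 144
            - (l ^ 2 - q ^ 2) ^ 4 * Real.sqrt (l ^ 2 - q ^ 2) / 43545600) * Real.exp (-(l * z)))
        (Set.Ioi q) ∧
      ∫ m in Set.Ioi (0 : ℝ), (m ^ 10 / 43545600 - m ^ 4 / 144) *
          (Real.exp (-(z * Real.sqrt (m ^ 2 + q ^ 2))) / Real.sqrt (m ^ 2 + q ^ 2)) =
        -∫ l in Set.Ioi q, ((l ^ 2 - q ^ 2) * Real.sqrt (l ^ 2 - q ^ 2) / 144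
            - (l ^ 2 - q ^ 2) ^ 4 * Real.sqrt (l ^ 2 - q ^ 2) / 43545600) * Real.exp (-(l * z))) →
    ∀ (V : Type) [NormedAddCommGroup V] [InnerProductSpace ℝ V] [FiniteDimensional ℝ V]
      [MeasurableSpace V] [BorelSpace V] (L : Submodule ℤ V) [DiscreteTopology L] [IsZLattice ℝ L],
      Module.finrank ℝ V = 2 →
      ∀ (x : V) (z : ℝ), 0 < z →
        Summable (fun l : L => lennardJones (Real.sqrt (‖x - l‖ ^ 2 + z ^ 2))) ∧
        Summable (fun w : dualLattice L =>
          (∫ l in Set.Ioi (2 * π * ‖(w : V)‖),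
              ((l ^ 2 - (2 * π * ‖(w : V)‖) ^ 2) * Real.sqrt (l ^ 2 - (2 * π * ‖(w : V)‖) ^ 2) / 144
                - (l ^ 2 - (2 * π * ‖(w : V)‖) ^ 2) ^ 4 * Real.sqrt (l ^ 2 - (2 * π * ‖(w : V)‖) ^ 2)
                    / 43545600) * Real.exp (-(l * z))) *
            Real.cos (2 * π * ⟪x, (w : V)⟫_ℝ)) ∧
        ∑' l : L, lennardJones (Real.sqrt (‖x - l‖ ^ 2 + z ^ 2)) =
          -(2 * π / ZLattice.covolume L) *
            ∑' w : dualLattice L,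
              (∫ l in Set.Ioi (2 * π * ‖(w : V)‖),
                  ((l ^ 2 - (2 * π * ‖(w : V)‖) ^ 2) * Real.sqrt (l ^ 2 - (2 * π * ‖(w : V)‖) ^ 2) / 144
                    - (l ^ 2 - (2 * π * ‖(w : V)‖) ^ 2) ^ 4 *
                        Real.sqrt (l ^ 2 - (2 * π * ‖(w : V)‖) ^ 2) / 43545600) *
                    Real.exp (-(l * z))) *
                Real.cos (2 * π * ⟪x, (w : V)⟫_ℝ) := by
  intro hSwap hSub V _ _ _ _ _ L _ _ hV x z hz
  have hb3 : (Module.finrank ℝ V : ℝ) < 3 := by rw [hV]; norm_num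
  have hb6 : (Module.finrank ℝ V : ℝ) < 6 := by rw [hV]; norm_num
  have hz2 : 0 < z / 2 := by positivity
  /- Step 1: hypothesis 1 for the family `R_l = √(‖x − l‖² + z²) ≥ z`, `Σ_l R_l⁻⁶ < ∞`. -/
  have hRz : ∀ l : L, z ≤ Real.sqrt (‖x - (l : V)‖ ^ 2 + z ^ 2) := fun l =>
    Real.le_sqrt_of_sq_le (by nlinarith [sq_nonneg ‖x - (l : V)‖])
  have hR6 : Summable fun l : L => (Real.sqrt (‖x - (l : V)‖ ^ 2 + z ^ 2))⁻¹ ^ 6 := by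
    have h := Literature.NumberTheory.LFunctions.Fourier.summable_of_decay_zlattice L hb6
      (g := fun v : V => (((Real.sqrt (‖x - v‖ ^ 2 + z ^ 2))⁻¹ ^ 6 : ℝ) : ℂ)) fun v => by
        rw [Complex.norm_real, Real.norm_of_nonneg (by positivity)]
        exact inv_sqrt_norm_sub_sq_add_sq_pow_six_le hz x v
    exact Complex.summable_ofReal.1 h
  obtain ⟨hLJ, -, -, hEq⟩ :=
    hSwap L (fun l : L => Real.sqrt (‖x - (l : V)‖ ^ 2 + z ^ 2)) z hz hRz hR6
  /- Step 2: dominated exchange of `∫_{m>0}` and `Σ'_{w ∈ L*}` for the mode integrands. -/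
  obtain ⟨-, hsumF, hswap⟩ := integral_Ioi_tsum_of_dominated
    (F := fun (w : dualLattice L) (m : ℝ) => (m ^ 10 / 43545600 - m ^ 4 / 144) *
      (Real.exp (-(z * Real.sqrt (m ^ 2 + (2 * π * ‖(w : V)‖) ^ 2))) /
          Real.sqrt (m ^ 2 + (2 * π * ‖(w : V)‖) ^ 2) * Real.cos (2 * π * ⟪x, (w : V)⟫_ℝ)))
    (fun w => (continuousOn_ljModeIntegrand z _ _).aestronglyMeasurable measurableSet_Ioi)
    (integrableOn_ljModeDominant hz2) (summable_exp_neg_mul_norm_zlattice (dualLattice L) hb3 hz2)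
    (fun w m hm => norm_ljModeIntegrand_le _ hz hm (Real.abs_cos_le_one _))
  /- Step 3: each mode integral by hypothesis 2 with `q = 2π‖w‖`. -/
  have hinner : ∀ w : dualLattice L,
      ∫ m in Set.Ioi (0 : ℝ), (m ^ 10 / 43545600 - m ^ 4 / 144) *
          (Real.exp (-(z * Real.sqrt (m ^ 2 + (2 * π * ‖(w : V)‖) ^ 2))) /
              Real.sqrt (m ^ 2 + (2 * π * ‖(w : V)‖) ^ 2) * Real.cos (2 * π * ⟪x, (w : V)⟫_ℝ)) =
        -(∫ l in Set.Ioi (2 * π * ‖(w : V)‖),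
            ((l ^ 2 - (2 * π * ‖(w : V)‖) ^ 2) * Real.sqrt (l ^ 2 - (2 * π * ‖(w : V)‖) ^ 2) / 144
              - (l ^ 2 - (2 * π * ‖(w : V)‖) ^ 2) ^ 4 *
                  Real.sqrt (l ^ 2 - (2 * π * ‖(w : V)‖) ^ 2) / 43545600) *
              Real.exp (-(l * z))) *
          Real.cos (2 * π * ⟪x, (w : V)⟫_ℝ) := by
    intro w
    rw [← (hSub (2 * π * ‖(w : V)‖) z (by positivity) hz).2, ← integral_mul_const]
    refine setIntegral_congr_fun measurableSet_Ioi fun m _ => ?_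
    ring
  refine ⟨hLJ, (hsumF.congr fun w => (hinner w).trans (neg_mul _ _)).of_neg, hEq.trans ?_⟩
  calc ∫ m in Set.Ioi (0 : ℝ), (m ^ 10 / 43545600 - m ^ 4 / 144) *
          ∑' l : L, Real.exp (-(m * Real.sqrt (‖x - (l : V)‖ ^ 2 + z ^ 2))) /
            Real.sqrt (‖x - (l : V)‖ ^ 2 + z ^ 2)
      = ∫ m in Set.Ioi (0 : ℝ), 2 * π / ZLattice.covolume L *
          ∑' w : dualLattice L, (m ^ 10 / 43545600 - m ^ 4 / 144) *
            (Real.exp (-(z * Real.sqrt (m ^ 2 + (2 * π * ‖(w : V)‖) ^ 2))) /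
                Real.sqrt (m ^ 2 + (2 * π * ‖(w : V)‖) ^ 2) *
              Real.cos (2 * π * ⟪x, (w : V)⟫_ℝ)) := by
        refine setIntegral_congr_fun measurableSet_Ioi fun m hm => ?_
        have hm' : (0 : ℝ) < m := hm
        have hme :=
          (stub_modeExpansionOfFourier stub_yukawaSliceFourier V L hV m z x hm' hz).2.2
        simp only [hme]
        rw [tsum_mul_left]
        ring
    _ = 2 * π / ZLattice.covolume L *
          ∑' w : dualLattice L, ∫ m in Set.Ioi (0 : ℝ), (m ^ 10 / 43545600 - m ^ 4 / 144) *
            (Real.exp (-(z * Real.sqrt (m ^ 2 + (2 * π * ‖(w : V)‖) ^ 2))) /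
                Real.sqrt (m ^ 2 + (2 * π * ‖(w : V)‖) ^ 2) *
              Real.cos (2 * π * ⟪x, (w : V)⟫_ℝ)) := by
        rw [integral_const_mul, hswap]
    _ = _ := by
        rw [tsum_congr hinner]
        simp_rw [neg_mul, tsum_neg, mul_neg]

end Summit.AtomisticToContinuum.Crystallization.Theorems.ChessboardParticlePlanesLjPlaneChessboard

end
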